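import Literature.Analysis.FluidPDE.WholeSpaceIBP
import Literature.Analysis.FluidPDE.PressurePoisson
import Literature.Analysis.FluidPDE.LerayHopfProofs
import HarnessLib

/-!
# The local energy identity for smooth solutions of the mollified Navier–Stokes system

Analysis/FluidPDE support file (serves the discharge of `NS.ess_suitable_of_L3infty'`,
Escauriaza–Seregin–Šverák 2003, proof of Thm. 1.4). For smooth fields `V, Nᵢ, P` on `ℝ × E`
satisfying, on the support of a test function `φ`, the mollified system
`⟪∂ₜV, bᵢ⟫ + div Nᵢ - ν ⟪ΔV, bᵢ⟫ + ∂ᵢP = 0`, `div V = 0` (as produced by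
`FluidPDE/SpaceTimeMollifier`), this file proves the classical local energy identity
`∫ φ(t)|V(t)|² + 2ν ∫∫ φ |DV|² = ∫∫ (|V|² (νΔφ + ∂ₜφ) + 2 Σᵢ (⟪Nᵢ, ∇φ⟫ Vᵢ + φ ⟪DV(Nᵢ), bᵢ⟫)
+ 2 P ⟪V, ∇φ⟫)` (multiply by `φ V`, integrate by parts in space, fundamental theorem of calculus
in time, Fubini; Caffarelli–Kohn–Nirenberg 1982, §2, (2.5) with equality for smooth solutions),
and the transport identity `2 ∫ φ ⟪DV(V), V⟫ = -∫ |V|² ⟪V, ∇φ⟫` for divergence-free `V`.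

## Contents (all proved)

* `integral_two_mul_inner_eq_of_momentum` — the slice identity at fixed time;
* `two_mul_integral_mul_inner_fderiv_self` — the transport identity at fixed time;
* `setIntegral_prod_univ_eq` — product-set integrals over `I × E` as iterated integrals;
* `local_energy_identity_smooth` — the space–time identity.

## Mathlib search

Mathlib has integration by parts on the whole space for integrable functions and the Laplacian;
the boundary-free identities used here (`∫ θ div u + ∫ ⟪u, ∇θ⟫ = 0`, the trilinear convection
identity, Green's first identity, `div ∇ = Δ`) are the tree's `FluidPDE/WholeSpaceIBP` and
`FluidPDE/PressurePoisson` (`divergence_gradient`), the joint space–time calculus is the tree's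
`FluidPDE/SpaceTimeCalculus` / `ClassicalSolutionCalculus`. No new definitions.

## References

* L. Caffarelli, R. Kohn, L. Nirenberg, *Partial regularity of suitable weak solutions of the
  Navier–Stokes equations*, CPAM 35 (1982), §2, (2.5).
* L. Escauriaza, G. Seregin, V. Šverák, *`L_{3,∞}`-solutions of Navier–Stokes equations and
  backward uniqueness*, Russ. Math. Surveys 58:2 (2003), Def. 2.1 (2.4), proof of Thm. 1.4.
-/

noncomputable section

open MeasureTheory TopologicalSpace Set Function Filter Topology InnerProductSpace
open scoped ENNReal NNReal Laplacian RealInnerProductSpace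

namespace Literature.Analysis.FluidPDE

open scoped ContDiff

/-! ### Pointwise calculus: gradients of products, `div ∇ = Δ`, the derivative of `|V|²` -/

section Pointwise

variable {E : Type*} [NormedAddCommGroup E] [InnerProductSpace ℝ E]

/-- The gradient of a `C^{n+1}` function is `Cⁿ`. [folklore] -/
theorem contDiff_gradient [CompleteSpace E] {θ : E → ℝ} {n : WithTop ℕ∞} (hθ : ContDiff ℝ (n + 1) θ) :
    ContDiff ℝ n (gradient θ) :=
  (InnerProductSpace.toDual ℝ E).symm.contDiff.comp (hθ.fderiv_right le_rfl)

/-- The gradient of a compactly supported function is compactly supported. [folklore] -/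
theorem hasCompactSupport_gradient [CompleteSpace E] {θ : E → ℝ} (hc : HasCompactSupport θ) :
    HasCompactSupport (gradient θ) :=
  hc.fderiv (𝕜 := ℝ) |>.comp_left (g := fun L => (InnerProductSpace.toDual ℝ E).symm L)
    (by simp)

variable [FiniteDimensional ℝ E]

omit [FiniteDimensional ℝ E] in
/-- Derivative of `|V|²` along `h`: `D(|V|²)(x) h = 2 ⟪V x, DV(x) h⟫`. [folklore] -/
theorem fderiv_norm_sq_comp_apply {F' : Type*} [NormedAddCommGroup F'] [InnerProductSpace ℝ F']
    {V : E → F'} {x : E} (hV : DifferentiableAt ℝ V x) (h : E) :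
    fderiv ℝ (fun y => ‖V y‖ ^ 2) x h = 2 * ⟪V x, fderiv ℝ V x h⟫ := by
  rw [(hV.hasFDerivAt.norm_sq).fderiv]
  simp [innerSL_apply_apply, two_smul]
  ring

end Pointwise

/-! ### The local energy identity for smooth fields: the fixed-time (slice) identity -/

section Slice

variable {E : Type*} [NormedAddCommGroup E] [InnerProductSpace ℝ E] [FiniteDimensional ℝ E]
  [MeasurableSpace E] [BorelSpace E]
variable {ι : Type*} [Fintype ι]

/-- A continuous function vanishing off the topological support of a compactly supported
function is integrable. [folklore] -/
theorem integrable_of_continuous_of_tsupport {F : Type*} [NormedAddCommGroup F] {f : E → F}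
    {φ : E → ℝ} (hf : Continuous f) (hφ : HasCompactSupport φ)
    (h : ∀ x, x ∉ tsupport φ → f x = 0) : Integrable f (volume : Measure E) :=
  hf.integrable_of_hasCompactSupport (HasCompactSupport.intro hφ h)

/-- **The slice identity behind the local energy equality.** Let `b` be an orthonormal basis of
`E`, `V ∈ C²(E; E)`, `W : E → E`, `Nᵢ ∈ C¹(E; E)`, `P ∈ C¹(E; ℝ)` and `φ ∈ C²_c(E; ℝ)`, and
assume that on `{φ ≠ 0}` the fields satisfy the (mollified) Navier–Stokes system
`⟪W, bᵢ⟫ + div Nᵢ - ν ⟪ΔV, bᵢ⟫ + ∂ᵢP = 0` for all `i` and `div V = 0` (think `W = ∂ₜV`,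
`Nᵢ = (uᵢ u)_ε`). Then
`∫ 2φ ⟪V, W⟫ = 2 Σᵢ ∫ (⟪Nᵢ, ∇φ⟫ ⟪V, bᵢ⟫ + φ ⟪DV(Nᵢ), bᵢ⟫) + ν ∫ |V|² Δφ - 2ν ∫ φ |DV|² + 2 ∫ P ⟪V, ∇φ⟫`
— multiply the equation by `φ V` and integrate by parts in space (Caffarelli–Kohn–Nirenberg
1982, §2, derivation of (2.5) for smooth solutions; Escauriaza–Seregin–Šverák 2003, §2,
Def. 2.1 (2.4)). [cite: CaffarelliKohnNirenberg1982, §2] -/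
theorem integral_two_mul_inner_eq_of_momentum (b : OrthonormalBasis ι ℝ E) {ν : ℝ}
    {V W : E → E} {N : ι → E → E} {P φ : E → ℝ}
    (hV : ContDiff ℝ 2 V) (hN : ∀ i, ContDiff ℝ 1 (N i)) (hP : ContDiff ℝ 1 P)
    (hφ : ContDiff ℝ 2 φ) (hφc : HasCompactSupport φ)
    (hmom : ∀ x, φ x ≠ 0 → ∀ i,
      ⟪W x, b i⟫ + VectorCalculus.divergence (N i) x - ν * ⟪(Δ V) x, b i⟫ + fderiv ℝ P x (b i) = 0)
    (hdiv : ∀ x, φ x ≠ 0 → VectorCalculus.divergence V x = 0) :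
    ∫ x, 2 * φ x * ⟪V x, W x⟫ =
      2 * (∑ i, ∫ x, (⟪N i x, gradient φ x⟫ * ⟪V x, b i⟫ + φ x * ⟪fderiv ℝ V x (N i x), b i⟫)) +
      ν * (∫ x, ‖V x‖ ^ 2 * (Δ φ) x) - 2 * ν * (∫ x, φ x * frobeniusNormSq (fderiv ℝ V x)) +
      2 * ∫ x, P x * ⟪V x, gradient φ x⟫ := by
  -- regularity bookkeeping
  have hV1 : ContDiff ℝ 1 V := hV.of_le one_le_two
  have hφ1 : ContDiff ℝ 1 φ := hφ.of_le one_le_two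
  have hVc : Continuous V := hV.continuous
  have hφc' : Continuous φ := hφ.continuous
  have hDV : Continuous (fderiv ℝ V) := hV1.continuous_fderiv one_ne_zero
  have hDφ : Continuous (fderiv ℝ φ) := hφ1.continuous_fderiv one_ne_zero
  have hgφ : Continuous (gradient φ) := continuous_gradient_of_contDiff hφ1
  have hgφ1 : ContDiff ℝ 1 (gradient φ) := contDiff_gradient (n := 1) hφ
  have hΔV : Continuous (Δ V) := continuous_laplacian hV
  have hΔφ : Continuous (Δ φ) := continuous_laplacian hφ
  have hdV : ∀ x, DifferentiableAt ℝ V x := fun x => hV1.differentiable one_ne_zero x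
  have hdφ : ∀ x, DifferentiableAt ℝ φ x := fun x => hφ1.differentiable one_ne_zero x
  have hoff : ∀ x, x ∉ tsupport φ → φ x = 0 := fun x hx => image_eq_zero_of_notMem_tsupport hx
  have hgoff : ∀ x, x ∉ tsupport φ → gradient φ x = 0 := fun x hx =>
    gradient_eq_zero_of_notMem_tsupport hx
  -- Step 0: the pointwise identity from the equation
  have hpt : ∀ x, φ x * ⟪V x, W x⟫ =
      -(∑ i, φ x * ⟪V x, b i⟫ * VectorCalculus.divergence (N i) x) + ν * (φ x * ⟪V x, (Δ V) x⟫) -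
        φ x * fderiv ℝ P x (V x) := by
    intro x
    by_cases hx : φ x = 0
    · simp [hx]
    have hm := hmom x hx
    have e1 : ⟪V x, W x⟫ = ∑ i, ⟪V x, b i⟫ * ⟪W x, b i⟫ := by
      rw [← b.sum_inner_mul_inner (V x) (W x)]
      exact Finset.sum_congr rfl fun i _ => by rw [real_inner_comm (b i) (W x)]
    have e2 : ∀ i, ⟪W x, b i⟫ = -VectorCalculus.divergence (N i) x + ν * ⟪(Δ V) x, b i⟫ - fderiv ℝ P x (b i) :=
      fun i => by linarith [hm i]
    have e3 : ∑ i, ⟪V x, b i⟫ * ⟪(Δ V) x, b i⟫ = ⟪V x, (Δ V) x⟫ := by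
      have h3 := b.sum_inner_mul_inner (V x) ((Δ V) x)
      rw [← h3]
      exact Finset.sum_congr rfl fun i _ => by congr 1; exact real_inner_comm _ _
    have e4 : ∑ i, ⟪V x, b i⟫ * fderiv ℝ P x (b i) = fderiv ℝ P x (V x) := by
      conv_rhs => rw [← b.sum_repr' (V x)]
      rw [map_sum]
      exact Finset.sum_congr rfl fun i _ => by rw [map_smul, smul_eq_mul, real_inner_comm]
    rw [e1]
    simp_rw [e2]
    have : ∑ i, ⟪V x, b i⟫ * (-VectorCalculus.divergence (N i) x + ν * ⟪(Δ V) x, b i⟫ - fderiv ℝ P x (b i)) =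
        -(∑ i, ⟪V x, b i⟫ * VectorCalculus.divergence (N i) x) + ν * ∑ i, ⟪V x, b i⟫ * ⟪(Δ V) x, b i⟫ -
          ∑ i, ⟪V x, b i⟫ * fderiv ℝ P x (b i) := by
      rw [Finset.mul_sum, ← Finset.sum_neg_distrib, ← Finset.sum_add_distrib,
        ← Finset.sum_sub_distrib]
      exact Finset.sum_congr rfl fun i _ => by ring
    rw [this, e3, e4]
    have e5 : ∑ i, φ x * ⟪V x, b i⟫ * VectorCalculus.divergence (N i) x =
        φ x * ∑ i, ⟪V x, b i⟫ * VectorCalculus.divergence (N i) x := by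
      rw [Finset.mul_sum]
      exact Finset.sum_congr rfl fun i _ => by ring
    rw [e5]
    ring
  -- integrability of the pieces (continuous, supported in `tsupport φ`)
  have iT : ∀ i, Integrable (fun x => φ x * ⟪V x, b i⟫ * VectorCalculus.divergence (N i) x) (volume : Measure E) :=
    fun i => integrable_of_continuous_of_tsupport
      ((hφc'.mul (hVc.inner continuous_const)).mul
        (continuous_divergence ((hN i).continuous_fderiv one_ne_zero))) hφc
      fun x hx => by simp [hoff x hx]
  have iL : Integrable (fun x => φ x * ⟪V x, (Δ V) x⟫) (volume : Measure E) :=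
    integrable_of_continuous_of_tsupport (hφc'.mul (hVc.inner hΔV)) hφc
      fun x hx => by simp [hoff x hx]
  have iP : Integrable (fun x => φ x * fderiv ℝ P x (V x)) (volume : Measure E) :=
    integrable_of_continuous_of_tsupport
      (hφc'.mul (((hP.continuous_fderiv one_ne_zero)).clm_apply hVc)) hφc
      fun x hx => by simp [hoff x hx]
  -- Step 1: integrate the pointwise identity
  have step1 : ∫ x, 2 * φ x * ⟪V x, W x⟫ =
      2 * (-(∑ i, ∫ x, φ x * ⟪V x, b i⟫ * VectorCalculus.divergence (N i) x) +
        ν * (∫ x, φ x * ⟪V x, (Δ V) x⟫) - ∫ x, φ x * fderiv ℝ P x (V x)) := by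
    have h1 : (fun x => 2 * φ x * ⟪V x, W x⟫) = fun x =>
        2 * (-(∑ i, φ x * ⟪V x, b i⟫ * VectorCalculus.divergence (N i) x) + ν * (φ x * ⟪V x, (Δ V) x⟫) -
          φ x * fderiv ℝ P x (V x)) := by
      funext x; rw [mul_assoc, hpt x]
    have i1 : Integrable (fun x => -(∑ i, φ x * ⟪V x, b i⟫ * VectorCalculus.divergence (N i) x))
        (volume : Measure E) := (integrable_finsetSum _ fun i _ => iT i).neg
    have i2 : Integrable (fun x => ν * (φ x * ⟪V x, (Δ V) x⟫)) (volume : Measure E) :=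
      iL.const_mul ν
    have i12 : Integrable (fun x => -(∑ i, φ x * ⟪V x, b i⟫ * VectorCalculus.divergence (N i) x) +
        ν * (φ x * ⟪V x, (Δ V) x⟫)) (volume : Measure E) := i1.add i2
    rw [h1, integral_const_mul, integral_sub i12 iP, integral_add i1 i2, integral_neg,
      integral_finsetSum _ (fun i _ => iT i), integral_const_mul]
  -- Step 2a: the transport term, `∫ (φ Vᵢ) div Nᵢ = -∫ ⟪Nᵢ, ∇(φ Vᵢ)⟫`
  have ibp1 : ∀ i, ∫ x, φ x * ⟪V x, b i⟫ * VectorCalculus.divergence (N i) x =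
      -∫ x, (⟪N i x, gradient φ x⟫ * ⟪V x, b i⟫ + φ x * ⟪fderiv ℝ V x (N i x), b i⟫) := by
    intro i
    have hθ : ContDiff ℝ 1 fun x => φ x * ⟪V x, b i⟫ := hφ1.mul (hV1.inner ℝ contDiff_const)
    have hθc : HasCompactSupport fun x => φ x * ⟪V x, b i⟫ :=
      hφc.mono' fun x hx => by contrapose! hx; simp [hoff x hx]
    have h := integral_mul_divergence_add_eq_zero_left hθ (hN i) hθc
    have hgrad : ∀ x, ⟪N i x, gradient (fun y => φ y * ⟪V y, b i⟫) x⟫ =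
        ⟪N i x, gradient φ x⟫ * ⟪V x, b i⟫ + φ x * ⟪fderiv ℝ V x (N i x), b i⟫ := fun x => by
      rw [inner_gradient_right_eq_fderiv,
        fderiv_fun_mul (hdφ x) ((hdV x).inner ℝ (differentiableAt_const _))]
      simp only [_root_.add_apply, _root_.FunLike.coe_smul, Pi.smul_apply, smul_eq_mul]
      rw [fderiv_inner_apply ℝ (hdV x) (differentiableAt_const _)]
      simp only [fderiv_fun_const, Pi.zero_apply, _root_.zero_apply, inner_zero_right,
        zero_add, inner_gradient_right_eq_fderiv]
      ring
    simp_rw [hgrad] at h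
    linarith
  -- Step 2b: the viscous term, `∫ φ ⟪V, ΔV⟫ = ½ ∫ |V|² Δφ - ∫ φ |DV|²`
  have ibp2 : ∫ x, φ x * ⟪V x, (Δ V) x⟫ =
      (1 / 2) * (∫ x, ‖V x‖ ^ 2 * (Δ φ) x) - ∫ x, φ x * frobeniusNormSq (fderiv ℝ V x) := by
    -- Green: `∫ ⟪ΔV, φV⟫ = -Σⱼ ∫ ⟪∂ⱼV, ∂ⱼ(φV)⟫`
    have hw : ContDiff ℝ 1 fun x => φ x • V x := hφ1.smul hV1
    have hwc : HasCompactSupport fun x => φ x • V x := hφc.smul_right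
    have h := integral_inner_laplacian_add_eq_zero b hV hw (Or.inr hwc)
    have hl : ∫ x, ⟪(Δ V) x, φ x • V x⟫ = ∫ x, φ x * ⟪V x, (Δ V) x⟫ :=
      integral_congr_ae (Eventually.of_forall fun x => by
        dsimp only
        rw [real_inner_smul_right, real_inner_comm])
    -- `∂ⱼ(φV) = (∂ⱼφ) V + φ ∂ⱼV`
    have hdj : ∀ i x, ⟪fderiv ℝ V x (b i), fderiv ℝ (fun y => φ y • V y) x (b i)⟫ =
        fderiv ℝ φ x (b i) * ⟪fderiv ℝ V x (b i), V x⟫ +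
          φ x * ‖fderiv ℝ V x (b i)‖ ^ 2 := fun i x => by
      rw [fderiv_fun_smul (hdφ x) (hdV x)]
      simp only [_root_.add_apply, _root_.FunLike.coe_smul, Pi.smul_apply,
        ContinuousLinearMap.smulRight_apply, inner_add_right, real_inner_smul_right,
        real_inner_self_eq_norm_sq]
      ring
    have iA : ∀ i, Integrable (fun x => fderiv ℝ φ x (b i) * ⟪fderiv ℝ V x (b i), V x⟫)
        (volume : Measure E) := fun i =>
      integrable_of_continuous_of_tsupport
        ((hDφ.clm_apply continuous_const).mul ((hDV.clm_apply continuous_const).inner hVc)) hφc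
        fun x hx => by simp [fderiv_of_notMem_tsupport ℝ hx]
    have iB : ∀ i, Integrable (fun x => φ x * ‖fderiv ℝ V x (b i)‖ ^ 2) (volume : Measure E) :=
      fun i => integrable_of_continuous_of_tsupport
        (hφc'.mul ((hDV.clm_apply continuous_const).norm.pow 2)) hφc
        fun x hx => by simp [hoff x hx]
    have hsum : ∑ i, ∫ x, ⟪fderiv ℝ V x (b i), fderiv ℝ (fun y => φ y • V y) x (b i)⟫ =
        (∫ x, ∑ i, fderiv ℝ φ x (b i) * ⟪fderiv ℝ V x (b i), V x⟫) +
          ∫ x, φ x * frobeniusNormSq (fderiv ℝ V x) := by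
      simp_rw [hdj]
      have h3 : ∀ i, ∫ x, (fderiv ℝ φ x (b i) * ⟪fderiv ℝ V x (b i), V x⟫ +
          φ x * ‖fderiv ℝ V x (b i)‖ ^ 2) = (∫ x, fderiv ℝ φ x (b i) * ⟪fderiv ℝ V x (b i), V x⟫) +
          ∫ x, φ x * ‖fderiv ℝ V x (b i)‖ ^ 2 := fun i => integral_add (iA i) (iB i)
      simp_rw [h3]
      rw [Finset.sum_add_distrib, ← integral_finsetSum _ fun i _ => iA i,
        ← integral_finsetSum _ fun i _ => iB i]
      congr 1
      refine integral_congr_ae (Eventually.of_forall fun x => ?_)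
      dsimp only
      rw [frobeniusNormSq_eq_sum b, Finset.mul_sum]
    -- `Σⱼ (∂ⱼφ) ⟪∂ⱼV, V⟫ = ½ ⟪∇φ, ∇|V|²⟫`
    have hhalf : ∀ x, ∑ i, fderiv ℝ φ x (b i) * ⟪fderiv ℝ V x (b i), V x⟫ =
        (1 / 2) * ⟪gradient φ x, gradient (fun y => ‖V y‖ ^ 2) x⟫ := fun x => by
      rw [inner_gradient_right_eq_fderiv, fderiv_norm_sq_comp_apply (hdV x)]
      conv_rhs => rw [← b.sum_repr' (gradient φ x), map_sum, inner_sum, Finset.mul_sum,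
        Finset.mul_sum]
      refine Finset.sum_congr rfl fun i _ => ?_
      rw [map_smul, real_inner_smul_right, inner_gradient_right_eq_fderiv, real_inner_comm]
      ring
    -- `∫ ⟪∇φ, ∇|V|²⟫ = -∫ |V|² Δφ`
    have hgreen : ∫ x, ⟪gradient φ x, gradient (fun y => ‖V y‖ ^ 2) x⟫ =
        -∫ x, ‖V x‖ ^ 2 * (Δ φ) x := by
      have h2 := integral_mul_divergence_add_eq_zero_right (hV1.norm_sq ℝ) hgφ1
        (hasCompactSupport_gradient hφc)
      simp_rw [divergence_gradient hφ] at h2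
      linarith
    rw [hl] at h
    have : ∫ x, ∑ i, fderiv ℝ φ x (b i) * ⟪fderiv ℝ V x (b i), V x⟫ =
        -(1 / 2) * ∫ x, ‖V x‖ ^ 2 * (Δ φ) x := by
      rw [integral_congr_ae (Eventually.of_forall hhalf), integral_const_mul, hgreen]
      ring
    rw [hsum, this] at h
    linarith
  -- Step 2c: the pressure term, `∫ φ DP(V) = -∫ P ⟪V, ∇φ⟫`
  have ibp3 : ∫ x, φ x * fderiv ℝ P x (V x) = -∫ x, P x * ⟪V x, gradient φ x⟫ := by
    have hw : ContDiff ℝ 1 fun x => φ x • V x := hφ1.smul hV1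
    have hwc : HasCompactSupport fun x => φ x • V x := hφc.smul_right
    have h := integral_inner_gradient_eq_neg_integral_mul_divergence hP hw hwc
    have hl : ∀ x, ⟪gradient P x, φ x • V x⟫ = φ x * fderiv ℝ P x (V x) := fun x => by
      rw [real_inner_smul_right, inner_gradient_left]
    have hr : ∀ x, P x * VectorCalculus.divergence (fun y => φ y • V y) x = P x * ⟪V x, gradient φ x⟫ := by
      intro x
      rw [divergence_smul_apply (hdφ x) (hdV x)]
      by_cases hx : φ x = 0
      · simp [hx]
      · rw [hdiv x hx]; ring
    simp_rw [hl, hr] at h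
    exact h
  -- assemble
  rw [step1]
  simp_rw [ibp1]
  rw [ibp2, ibp3, Finset.sum_neg_distrib]
  ring

/-- **The transport term against `φ|V|²` vanishes for divergence-free fields** (slice form of
`∫ (v·∇)v · φ v = -½ ∫ |v|² v·∇φ`): for `V ∈ C¹(E; E)` with `div V = 0` on `{φ ≠ 0}` and
`φ ∈ C¹_c`, `2 ∫ φ ⟪DV(V), V⟫ = -∫ |V|² ⟪V, ∇φ⟫` (Caffarelli–Kohn–Nirenberg 1982, §2, the
identity turning `u·∇(|u|²/2)` into `(|u|²/2) u·∇φ` in (2.5)). [cite: CaffarelliKohnNirenberg1982, §2] -/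
theorem two_mul_integral_mul_inner_fderiv_self {V : E → E} {φ : E → ℝ} (hV : ContDiff ℝ 1 V)
    (hφ : ContDiff ℝ 1 φ) (hφc : HasCompactSupport φ)
    (hdiv : ∀ x, φ x ≠ 0 → VectorCalculus.divergence V x = 0) :
    2 * ∫ x, φ x * ⟪fderiv ℝ V x (V x), V x⟫ = -∫ x, ‖V x‖ ^ 2 * ⟪V x, gradient φ x⟫ := by
  have hdV : ∀ x, DifferentiableAt ℝ V x := fun x => hV.differentiable one_ne_zero x
  have hdφ : ∀ x, DifferentiableAt ℝ φ x := fun x => hφ.differentiable one_ne_zero x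
  have hw : ContDiff ℝ 1 fun x => φ x • V x := hφ.smul hV
  have hwc : HasCompactSupport fun x => φ x • V x := hφc.smul_right
  -- `∫ |V|² div(φV) + ∫ ⟪φV, ∇|V|²⟫ = 0`
  have h := integral_mul_divergence_add_eq_zero_right (hV.norm_sq ℝ) hw hwc
  have hl : ∀ x, ‖V x‖ ^ 2 * VectorCalculus.divergence (fun y => φ y • V y) x =
      ‖V x‖ ^ 2 * ⟪V x, gradient φ x⟫ := fun x => by
    rw [divergence_smul_apply (hdφ x) (hdV x)]
    by_cases hx : φ x = 0
    · simp [hx]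
    · rw [hdiv x hx]; ring
  have hr : ∀ x, ⟪φ x • V x, gradient (fun y => ‖V y‖ ^ 2) x⟫ =
      2 * (φ x * ⟪fderiv ℝ V x (V x), V x⟫) := fun x => by
    rw [inner_gradient_right_eq_fderiv, fderiv_norm_sq_comp_apply (hdV x), map_smul,
      real_inner_smul_right, real_inner_comm]
  rw [integral_congr_ae (Eventually.of_forall hl), integral_congr_ae (Eventually.of_forall hr),
    integral_const_mul] at h
  linarith

end Slice

/-! ### The local energy identity for smooth fields: space–time form -/

section SpaceTime

variable {E : Type*} [NormedAddCommGroup E] [InnerProductSpace ℝ E] [FiniteDimensional ℝ E]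
  [MeasurableSpace E] [BorelSpace E]
variable {ι : Type*} [Fintype ι]

omit [FiniteDimensional ℝ E] [MeasurableSpace E] [BorelSpace E] in
/-- A jointly smooth field on all of space–time is jointly continuous. [folklore] -/
theorem IsSmoothSpaceTimeOn.continuous_uncurry {F : Type*} [NormedAddCommGroup F] [NormedSpace ℝ F]
    {w : ℝ → E → F} (h : IsSmoothSpaceTimeOn univ w) : Continuous (uncurry w) := by
  have := h.continuousOn
  rwa [univ_prod_univ, continuousOn_univ] at this

/-- **Product-set integrals over `I × E` as iterated integrals** for integrands integrable with
respect to `dt|_I ⊗ dx`. [folklore] -/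
theorem setIntegral_prod_univ_eq {F' : Type*} [NormedAddCommGroup F'] [NormedSpace ℝ F']
    {T : ℝ × E → F'} {I : Set ℝ}
    (hT : Integrable T (((volume : Measure ℝ).restrict I).prod (volume : Measure E))) :
    ∫ z in I ×ˢ (univ : Set E), T z = ∫ s in I, ∫ y, T (s, y) := by
  rw [Measure.volume_eq_prod, setIntegral_prod T, Measure.restrict_univ]
  rw [IntegrableOn, ← Measure.restrict_prod_eq_prod_univ]
  exact hT

/-- **The local energy identity for smooth solutions of the mollified system** (space–time
form). Let `V, Nᵢ, P` be jointly `C^∞` on `ℝ × E`, `φ` a space–time test function with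
`φ(a, ·) = 0`, and assume that for `s ∈ (a, t)` the fields satisfy, on `{φ(s, ·) ≠ 0}`, the system
`⟪∂ₜV, bᵢ⟫ + div Nᵢ - ν ⟪ΔV, bᵢ⟫ + ∂ᵢP = 0`, `div V = 0`. Then
`∫ φ(t)|V(t)|² + 2ν ∫∫_{(a,t)×E} φ |DV|² = ∫∫_{(a,t)×E} (|V|² (νΔφ + ∂ₜφ) + 2 Σᵢ (⟪Nᵢ, ∇φ⟫ Vᵢ + φ ⟪DV(Nᵢ), bᵢ⟫) + 2 P ⟪V, ∇φ⟫)`: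
the slice identity `integral_two_mul_inner_eq_of_momentum`, the fundamental theorem of calculus
on each time line `s ↦ φ(s, y)|V(s, y)|²` and Fubini (Caffarelli–Kohn–Nirenberg 1982, §2,
(2.5) with equality for smooth solutions; Escauriaza–Seregin–Šverák 2003, Def. 2.1 (2.4)). [cite: CaffarelliKohnNirenberg1982, §2] -/
theorem local_energy_identity_smooth (b : OrthonormalBasis ι ℝ E) {ν a t : ℝ} (hat : a ≤ t)
    {V : ℝ → E → E} {N : ι → ℝ → E → E} {P : ℝ → E → ℝ} {φ : ℝ → E → ℝ} {Ω : Opens (ℝ × E)}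
    (hV : ContDiff ℝ ∞ (uncurry V)) (hN : ∀ i, ContDiff ℝ ∞ (uncurry (N i)))
    (hP : ContDiff ℝ ∞ (uncurry P)) (hφ : IsSpaceTimeTestOn Ω φ) (hφa : ∀ y, φ a y = 0)
    (hmom : ∀ s ∈ Ioo a t, ∀ y, φ s y ≠ 0 → ∀ i,
      ⟪timeDeriv V s y, b i⟫ + VectorCalculus.divergence (N i s) y - ν * ⟪(Δ (V s)) y, b i⟫ +
        fderiv ℝ (P s) y (b i) = 0)
    (hdiv : ∀ s ∈ Ioo a t, ∀ y, φ s y ≠ 0 → VectorCalculus.divergence (V s) y = 0) :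
    (∫ y, φ t y * ‖V t y‖ ^ 2) +
      2 * ν * ∫ z in Ioo a t ×ˢ (univ : Set E), φ z.1 z.2 * frobeniusNormSq (fderiv ℝ (V z.1) z.2) =
    ∫ z in Ioo a t ×ˢ (univ : Set E), (‖V z.1 z.2‖ ^ 2 * (ν * (Δ (φ z.1)) z.2 + timeDeriv φ z.1 z.2) +
      2 * (∑ i, (⟪N i z.1 z.2, gradient (φ z.1) z.2⟫ * ⟪V z.1 z.2, b i⟫ +
        φ z.1 z.2 * ⟪fderiv ℝ (V z.1) z.2 (N i z.1 z.2), b i⟫)) +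
      2 * (P z.1 z.2 * ⟪V z.1 z.2, gradient (φ z.1) z.2⟫)) := by
  -- the compact `x`-shadow of `φ`
  obtain ⟨K, hK, hKt⟩ := hφ.exists_compact_slice_subset
  have hφK : ∀ s, ∀ y ∉ K, y ∉ tsupport (φ s) := fun s y hy h => hy (hKt s h)
  have hφ0 : ∀ s, ∀ y ∉ K, φ s y = 0 := fun s y hy =>
    image_eq_zero_of_notMem_tsupport (hφK s y hy)
  -- joint smoothness and continuity of all the fields involved
  have sV : IsSmoothSpaceTimeOn univ V := hV.contDiffOn
  have sφ : IsSmoothSpaceTimeOn univ φ := hφ.isSmoothSpaceTimeOn univ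
  have sP : IsSmoothSpaceTimeOn univ P := hP.contDiffOn
  have sN : ∀ i, IsSmoothSpaceTimeOn univ (N i) := fun i => (hN i).contDiffOn
  have sTV : IsSmoothSpaceTimeOn univ (timeDeriv V) := by
    rw [timeDeriv_eq_timeDerivWithin_univ]; exact sV.timeDerivWithin uniqueDiffOn_univ
  have sDV : IsSmoothSpaceTimeOn univ (fun s y => fderiv ℝ (V s) y) :=
    sV.fderiv_slice uniqueDiffOn_univ
  have sΔφ : IsSmoothSpaceTimeOn univ (fun s y => (Δ (φ s)) y) := sφ.laplacian uniqueDiffOn_univ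
  have sgφ : IsSmoothSpaceTimeOn univ (fun s y => gradient (φ s) y) :=
    sφ.gradient uniqueDiffOn_univ
  have sTφ : IsSmoothSpaceTimeOn univ (timeDeriv φ) := hφ.isSmoothSpaceTimeOn_timeDeriv
  have cV : Continuous (uncurry V) := hV.continuous
  have cφ : Continuous (uncurry φ) := hφ.contDiff.continuous
  have cP : Continuous (uncurry P) := hP.continuous
  have cN : ∀ i, Continuous (uncurry (N i)) := fun i => (hN i).continuous
  have cTV : Continuous (uncurry (timeDeriv V)) := sTV.continuous_uncurry
  have cDV : Continuous (uncurry fun s y => fderiv ℝ (V s) y) := sDV.continuous_uncurry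
  have cΔφ : Continuous (uncurry fun s y => (Δ (φ s)) y) := sΔφ.continuous_uncurry
  have cgφ : Continuous (uncurry fun s y => gradient (φ s) y) := sgφ.continuous_uncurry
  have cTφ : Continuous (uncurry (timeDeriv φ)) := hφ.continuous_timeDeriv
  -- vanishing outside `K`
  have hg0 : ∀ s, ∀ y ∉ K, gradient (φ s) y = 0 := fun s y hy =>
    gradient_eq_zero_of_notMem_tsupport (hφK s y hy)
  have hΔ0 : ∀ s, ∀ y ∉ K, (Δ (φ s)) y = 0 := fun s y hy =>
    laplacian_eq_zero_of_notMem_tsupport (hφK s y hy)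
  have hT0 : ∀ s, ∀ y ∉ K, timeDeriv φ s y = 0 := fun s y hy =>
    timeDeriv_eq_zero_of_forall (fun s' => hφ0 s' y hy) s
  -- the integrands
  set D : ℝ × E → ℝ := fun z => timeDeriv φ z.1 z.2 * ‖V z.1 z.2‖ ^ 2 +
    φ z.1 z.2 * (2 * ⟪V z.1 z.2, timeDeriv V z.1 z.2⟫) with hD
  set X : ℝ × E → ℝ := fun z => ∑ i, (⟪N i z.1 z.2, gradient (φ z.1) z.2⟫ * ⟪V z.1 z.2, b i⟫ +
    φ z.1 z.2 * ⟪fderiv ℝ (V z.1) z.2 (N i z.1 z.2), b i⟫) with hX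
  set T1 : ℝ × E → ℝ := fun z => timeDeriv φ z.1 z.2 * ‖V z.1 z.2‖ ^ 2 with hT1
  set T3 : ℝ × E → ℝ := fun z => ‖V z.1 z.2‖ ^ 2 * (Δ (φ z.1)) z.2 with hT3
  set Gd : ℝ × E → ℝ := fun z => φ z.1 z.2 * frobeniusNormSq (fderiv ℝ (V z.1) z.2) with hGd
  set T5 : ℝ × E → ℝ := fun z => P z.1 z.2 * ⟪V z.1 z.2, gradient (φ z.1) z.2⟫ with hT5
  set F : ℝ × E → ℝ := fun z => ‖V z.1 z.2‖ ^ 2 * (ν * (Δ (φ z.1)) z.2 + timeDeriv φ z.1 z.2) +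
    2 * X z + 2 * T5 z with hF
  -- continuity of the integrands
  have cX : Continuous X := by
    refine continuous_finsetSum _ fun i _ => ?_
    refine ((cN i).inner cgφ).mul (cV.inner continuous_const) |>.add (cφ.mul ?_)
    exact (isBoundedBilinearMap_apply.continuous.comp (cDV.prodMk (cN i))).inner continuous_const
  have cT1 : Continuous T1 := cTφ.mul (cV.norm.pow 2)
  have cT3 : Continuous T3 := (cV.norm.pow 2).mul cΔφ
  have cGd : Continuous Gd := cφ.mul (LerayHopfProofs.continuous_frobeniusNormSq.comp cDV)
  have cT5 : Continuous T5 := cP.mul (cV.inner cgφ)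
  have cD : Continuous D := cT1.add (cφ.mul (continuous_const.mul (cV.inner cTV)))
  have cF : Continuous F :=
    (((cV.norm.pow 2).mul ((continuous_const.mul cΔφ).add cTφ)).add (continuous_const.mul cX)).add
      (continuous_const.mul cT5)
  -- vanishing of the integrands off `K`
  have X0 : ∀ s, ∀ y ∉ K, X (s, y) = 0 := fun s y hy => by
    simp only [hX, hg0 s y hy, hφ0 s y hy, inner_zero_right, zero_mul, add_zero,
      Finset.sum_const_zero]
  have T10 : ∀ s, ∀ y ∉ K, T1 (s, y) = 0 := fun s y hy => by simp only [hT1, hT0 s y hy, zero_mul]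
  have T30 : ∀ s, ∀ y ∉ K, T3 (s, y) = 0 := fun s y hy => by simp only [hT3, hΔ0 s y hy, mul_zero]
  have Gd0 : ∀ s, ∀ y ∉ K, Gd (s, y) = 0 := fun s y hy => by simp only [hGd, hφ0 s y hy, zero_mul]
  have T50 : ∀ s, ∀ y ∉ K, T5 (s, y) = 0 := fun s y hy => by
    simp only [hT5, hg0 s y hy, inner_zero_right, mul_zero]
  have D0 : ∀ s, ∀ y ∉ K, D (s, y) = 0 := fun s y hy => by
    simp only [hD, hT0 s y hy, hφ0 s y hy, zero_mul, add_zero]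
  have F0 : ∀ s, ∀ y ∉ K, F (s, y) = 0 := fun s y hy => by
    simp only [hF, X0 s y hy, T50 s y hy, hΔ0 s y hy, hT0 s y hy, mul_zero, add_zero]
  -- slice-wise integrability (continuous with support in `K`)
  have islice : ∀ {T : ℝ × E → ℝ}, Continuous T → (∀ s, ∀ y ∉ K, T (s, y) = 0) → ∀ s,
      Integrable (fun y => T (s, y)) (volume : Measure E) := fun hc h0 s =>
    (hc.comp (Continuous.prodMk_right s)).integrable_of_hasCompactSupport
      (HasCompactSupport.intro hK fun y hy => h0 s y hy)
  -- Step A: the pointwise time derivative of `φ |V|²`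
  have hderiv : ∀ s y, HasDerivAt (fun s => φ s y * ‖V s y‖ ^ 2) (D (s, y)) s := by
    intro s y
    have h1 : HasDerivAt (fun s => V s y) (timeDeriv V s y) s := by
      have := sV.hasDerivAt_timeLine isOpen_univ (mem_univ s) y
      rwa [← timeDeriv_apply] at this
    exact (hφ.hasDerivAt_time s y).mul h1.norm_sq
  -- Step B: the fundamental theorem of calculus on each time line
  have hline : ∀ y, ∫ s in Ioo a t, D (s, y) = φ t y * ‖V t y‖ ^ 2 := by
    intro y
    have hint : IntervalIntegrable (fun s => D (s, y)) volume a t :=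
      (cD.comp (Continuous.prodMk_left y)).intervalIntegrable _ _
    have := intervalIntegral.integral_eq_sub_of_hasDerivAt (fun s _ => hderiv s y) hint
    rw [intervalIntegral.integral_of_le hat, integral_Ioc_eq_integral_Ioo] at this
    rw [this, hφa y, zero_mul, sub_zero]
  -- Step C: Fubini for `D`
  have hDint := integrable_prod_of_continuousOn (a := a) (b := t) hK cD.continuousOn
    (fun s _ y hy => D0 s y hy)
  have stepC : ∫ y, φ t y * ‖V t y‖ ^ 2 = ∫ s in Ioo a t, ∫ y, D (s, y) := by
    simp_rw [← hline]
    exact (integral_integral_swap (f := fun s y => D (s, y)) hDint).symm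
  -- Step D: the slice identity at each time `s ∈ (a, t)`
  have hslice : ∀ s ∈ Ioo a t, ∫ y, D (s, y) =
      (∫ y, T1 (s, y)) + (2 * (∑ i, ∫ y, (⟪N i s y, gradient (φ s) y⟫ * ⟪V s y, b i⟫ +
        φ s y * ⟪fderiv ℝ (V s) y (N i s y), b i⟫)) + ν * (∫ y, T3 (s, y)) -
        2 * ν * (∫ y, Gd (s, y)) + 2 * ∫ y, T5 (s, y)) := by
    intro s hs
    have hVs : ContDiff ℝ 2 (V s) := (sV.contDiff_slice (mem_univ s)).of_le (by
      change ((2 : ℕ∞) : WithTop ℕ∞) ≤ ((⊤ : ℕ∞) : WithTop ℕ∞); exact_mod_cast le_top)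
    have hNs : ∀ i, ContDiff ℝ 1 (N i s) := fun i =>
      ((sN i).contDiff_slice (mem_univ s)).of_le (by exact_mod_cast le_top)
    have hPs : ContDiff ℝ 1 (P s) := (sP.contDiff_slice (mem_univ s)).of_le (by exact_mod_cast le_top)
    have hφs : ContDiff ℝ 2 (φ s) := (sφ.contDiff_slice (mem_univ s)).of_le (by
      change ((2 : ℕ∞) : WithTop ℕ∞) ≤ ((⊤ : ℕ∞) : WithTop ℕ∞); exact_mod_cast le_top)
    have key := integral_two_mul_inner_eq_of_momentum b (ν := ν) (W := timeDeriv V s) hVs hNs hPs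
      hφs (hφ.hasCompactSupport_slice s) (hmom s hs) (hdiv s hs)
    have i1 := islice cT1 T10 s
    have i2 : Integrable (fun y => φ s y * (2 * ⟪V s y, timeDeriv V s y⟫)) (volume : Measure E) :=
      (islice cD D0 s).sub i1 |>.congr (Eventually.of_forall fun y => by
        simp only [hD, hT1, Pi.sub_apply]; ring)
    have e1 : ∫ y, D (s, y) = (∫ y, T1 (s, y)) + ∫ y, φ s y * (2 * ⟪V s y, timeDeriv V s y⟫) := by
      rw [← integral_add i1 i2]
    have e2 : ∫ y, φ s y * (2 * ⟪V s y, timeDeriv V s y⟫) = ∫ y, 2 * φ s y * ⟪V s y, timeDeriv V s y⟫ :=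
      integral_congr_ae (Eventually.of_forall fun y => by ring)
    rw [e1, e2, key]
  -- Step E: integrate the slice identity in time and pass to product integrals
  have hXint := integrable_prod_of_continuousOn (a := a) (b := t) hK cX.continuousOn
    (fun s _ y hy => X0 s y hy)
  have hT1int := integrable_prod_of_continuousOn (a := a) (b := t) hK cT1.continuousOn
    (fun s _ y hy => T10 s y hy)
  have hT3int := integrable_prod_of_continuousOn (a := a) (b := t) hK cT3.continuousOn
    (fun s _ y hy => T30 s y hy)
  have hGdint := integrable_prod_of_continuousOn (a := a) (b := t) hK cGd.continuousOn
    (fun s _ y hy => Gd0 s y hy)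
  have hT5int := integrable_prod_of_continuousOn (a := a) (b := t) hK cT5.continuousOn
    (fun s _ y hy => T50 s y hy)
  have hFint := integrable_prod_of_continuousOn (a := a) (b := t) hK cF.continuousOn
    (fun s _ y hy => F0 s y hy)
  -- per-slice decomposition of `∫ F(s, ·)`
  have hFslice : ∀ s, ∫ y, F (s, y) = ν * (∫ y, T3 (s, y)) + (∫ y, T1 (s, y)) +
      2 * (∑ i, ∫ y, (⟪N i s y, gradient (φ s) y⟫ * ⟪V s y, b i⟫ +
        φ s y * ⟪fderiv ℝ (V s) y (N i s y), b i⟫)) + 2 * ∫ y, T5 (s, y) := by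
    intro s
    have iX := islice cX X0 s
    have i1 := islice cT1 T10 s
    have i3 := islice cT3 T30 s
    have i5 := islice cT5 T50 s
    have iXi : ∀ i, Integrable (fun y => ⟪N i s y, gradient (φ s) y⟫ * ⟪V s y, b i⟫ +
        φ s y * ⟪fderiv ℝ (V s) y (N i s y), b i⟫) (volume : Measure E) := fun i =>
      ((((cN i).inner cgφ).mul (cV.inner continuous_const)).add (cφ.mul
        ((isBoundedBilinearMap_apply.continuous.comp (cDV.prodMk (cN i))).inner
          continuous_const))).comp (Continuous.prodMk_right s)
        |>.integrable_of_hasCompactSupport (HasCompactSupport.intro hK fun y hy => by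
          simp [hg0 s y hy, hφ0 s y hy])
    have eX : ∫ y, X (s, y) = ∑ i, ∫ y, (⟪N i s y, gradient (φ s) y⟫ * ⟪V s y, b i⟫ +
        φ s y * ⟪fderiv ℝ (V s) y (N i s y), b i⟫) := by
      simp only [hX]
      exact integral_finsetSum _ fun i _ => iXi i
    have ia : Integrable (fun y => ν * T3 (s, y) + T1 (s, y)) (volume : Measure E) :=
      (i3.const_mul ν).add i1
    have ib : Integrable (fun y => 2 * X (s, y)) (volume : Measure E) := iX.const_mul 2
    have ic : Integrable (fun y => 2 * T5 (s, y)) (volume : Measure E) := i5.const_mul 2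
    have iab : Integrable (fun y => ν * T3 (s, y) + T1 (s, y) + 2 * X (s, y)) (volume : Measure E) :=
      ia.add ib
    have i3' : Integrable (fun y => ν * T3 (s, y)) (volume : Measure E) := i3.const_mul ν
    have eF : (fun y => F (s, y)) = fun y => (ν * T3 (s, y) + T1 (s, y)) + 2 * X (s, y) +
        2 * T5 (s, y) := by
      funext y; simp only [hF, hT3, hT1]; ring
    rw [eF, integral_add iab ic, integral_add ia ib, integral_add i3' i1,
      integral_const_mul, integral_const_mul, integral_const_mul, eX]
  have hslice' : ∀ s ∈ Ioo a t, ∫ y, D (s, y) = (∫ y, F (s, y)) - 2 * ν * ∫ y, Gd (s, y) := by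
    intro s hs
    rw [hslice s hs, hFslice s]
    ring
  have hFl : Integrable (fun s => ∫ y, F (s, y)) (volume.restrict (Ioo a t)) := hFint.integral_prod_left
  have hGl : Integrable (fun s => ∫ y, Gd (s, y)) (volume.restrict (Ioo a t)) :=
    hGdint.integral_prod_left
  have stepE : ∫ s in Ioo a t, ∫ y, D (s, y) =
      (∫ s in Ioo a t, ∫ y, F (s, y)) - 2 * ν * ∫ s in Ioo a t, ∫ y, Gd (s, y) := by
    rw [setIntegral_congr_fun measurableSet_Ioo hslice', integral_sub hFl (hGl.const_mul _),
      integral_const_mul]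
  -- product integrals
  rw [setIntegral_prod_univ_eq hGdint, setIntegral_prod_univ_eq hFint, stepC, stepE]
  ring

end SpaceTime

end Literature.Analysis.FluidPDE
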